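import Summits.CriticalPhenomena.CardyFormulaZ2.Theorems.CardyIKTransportIKLinearTransportRatioMixStub
import Summits.CriticalPhenomena.CardyFormulaZ2.Theorems.CardyIKTransportIKLinearTransportScreeningGlue
import Summits.CriticalPhenomena.CardyFormulaZ2.Theorems.CardyIKTransportIKMixedBoxCrossingStubMonotone
import Summits.CriticalPhenomena.CardyFormulaZ2.Theorems.CardyIKTransportIKMixedBoxCrossingStubPatternLocality
import Summits.CriticalPhenomena.CardyFormulaZ2.Theorems.CardyIKTransportIKMixedBoxCrossingStubQuarterTurn
import Summits.CriticalPhenomena.CardyFormulaZ2.Theorems.CardyIKTransportIKMixedBoxCrossingDefectGlueColDefs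
import Summits.CriticalPhenomena.CardyFormulaZ2.Theorems.CardyIKTransportIKMixedBoxCrossingStubPolyDoubling

/-!
# `CardyIKTransport.IKLinearTransport` (stmt-CriticalPhenomena-5076), line `pinned-diagram-exchange` — HARD CROSSINGS OF LONG
# ISOTROPIC BOXES DECAY EXPONENTIALLY IN THE ASPECT RATIO (lead c7; the FKG-free upper half of RSW for the isotropic model)

Support file (`--supports stmt-CriticalPhenomena-5076`; registered sub-goal `pureIK_hardCrossing_decay`).

Companion of `…FarRSWAllAspects.lean` (p146877: box crossings of the isotropic Izergin–Korepin model at every aspect ratio are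
bounded BELOW).  Here: they are bounded ABOVE by a geometric sequence in the aspect ratio — for every `η > 0`, at scales
`n ≥ N(η)`, `P_univ[LR((2m+1) n × n)] ≤ ½ · ((1+η)/2)^m` — WITHOUT positive association: a left–right crossing of the long box crosses
each of the `m+1` squares `[a + 2jn, a + 2jn + n) × [b, b+n)` (`lrCross_subset_subbox`, two discrete intermediate-value cuts), consecutive
squares are at sup-distance `n`, the intersection of the first `j` square crossings is determined far from the next square, so the landed
RATIO MIXING of the line (`stub_RatioMix`, p130455: screening of the gauge at rate `(7−4√3)^n`) multiplies the probabilities up to `1+η`, and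
every square of the isotropic model is crossed with probability exactly `½` (`pLR_square_univ`).  Consequence (`pureIK_easyCrossing`): the
SHORT-way crossings of long isotropic boxes are exponentially certain, `P_univ[BT((2m+1) n × n)] ≥ 1 − ½((1+η)/2)^m`.
-/

noncomputable section

namespace Summit.CriticalPhenomena.CardyFormulaZ2.Theorems.IKLinearTransport.PinnedDiagramExchange.HardCrossingDecay

open Summit.CriticalPhenomena.CardyFormulaZ2.Theorems.IKLinearTransport.PinnedDiagramExchange
open Summit.CriticalPhenomena.CardyFormulaZ2.Cruxes.IKMixedBoxCrossing.PairedMirrorExploration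
open Summit.CriticalPhenomena.CardyFormulaZ2.Cruxes.IKMixedBoxCrossing.PairedMirrorExploration.DualityStub
  (measurableSet_lrCross measurableSet_tbCross)
open Summit.CriticalPhenomena.CardyFormulaZ2.Cruxes.IKMixedBoxCrossing.PairedMirrorExploration.PolyDoublingStub
  (determinedOn_mono)
open Summit.CriticalPhenomena.CardyFormulaZ2.Cruxes.IKMixedBoxCrossing.DefectClosureExploration
open MeasureTheory Literature.Probability.Percolation Literature.Probability.LatticeModels

/-! ## §1 (Determination lemmas `determinedOn_mono`, `inter_mem_determinedOn` are the sister line's, `PolyDoublingStub`.) -/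

/-! ## §2 A left–right crossing of a long box crosses every sub-box of full height -/

/-- SAME RIGHT EDGE: a black LR crossing of the `(e + w) × h` box at `(a, b)` contains a black LR crossing of the `w × h` box at `(a + e, b)`
(`1 ≤ w`): walk the crossing BACKWARDS from its right end; the first coordinate moves by at most `1` per edge, so the walk meets the column
`a + e`, and its initial segment up to that visit stays in the columns `≥ a + e` (`MonotoneStub.exists_reachable_level` with the label
`-v 0`). [folklore] -/
theorem lrCross_subset_right {a b : ℤ} {w e h : ℕ} (hw : 1 ≤ w) : lrCross a b (e + w) h ⊆ lrCross (a + e) b w h := by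
  intro x hx
  simp only [lrCross, Set.mem_setOf_eq, mem_openCrossing_iff] at hx ⊢
  obtain ⟨u, ⟨hu0, hu1, hu2⟩, v, ⟨hv0, hv1, hv2⟩, huS, hvS, ⟨p⟩⟩ := hx
  have hwZ : (1 : ℤ) ≤ w := by exact_mod_cast hw
  have hf : ∀ y z : Site 2, (openGraph (blackEdges x)).Adj y z → (fun q : Site 2 => -q 0) z ≤ (fun q : Site 2 => -q 0) y + 1 :=
    fun y z hyz => by have := MonotoneStub.apply_zero_le_of_adj x z y hyz.symm; simp only; omega
  obtain ⟨z, hz, hvT, hfz, hr⟩ := MonotoneStub.exists_reachable_level hf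
    (S := {q : Site 2 | a ≤ q 0 ∧ q 0 < a + ((e + w : ℕ) : ℤ) ∧ b ≤ q 1 ∧ q 1 < b + h})
    (T := {q : Site 2 | a + e ≤ q 0 ∧ q 0 < a + e + (w : ℤ) ∧ b ≤ q 1 ∧ q 1 < b + h}) (c := -(a + e))
    (fun q hq hqc => ⟨by omega, by have := hq.2.1; push_cast at this; omega, hq.2.2⟩)
    (u := ⟨v, hvS⟩) (v := ⟨u, huS⟩) p.reverse (by simp only; push_cast at hv0; omega) (by simp only; omega)
  refine ⟨z, ⟨by omega, hz.2.2⟩, v, ⟨by push_cast at hv0 ⊢; omega, hv1, hv2⟩, hz, hvT, hr.symm⟩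

/-- SUB-BOXES: a black LR crossing of the `W × h` box at `(a, b)` contains a black LR crossing of every `w × h` box at `(a + e, b)` with
`e + w ≤ W`, `1 ≤ w` (cut on the right by `MonotoneStub.lrCross_subset`, then on the left by `lrCross_subset_right`). [folklore] -/
theorem lrCross_subset_subbox {a b : ℤ} {W w e h : ℕ} (hw : 1 ≤ w) (heW : e + w ≤ W) :
    lrCross a b W h ⊆ lrCross (a + e) b w h :=
  (MonotoneStub.lrCross_subset (w := e + w) (by omega) heW).trans (lrCross_subset_right hw)

/-! ## §3 The squares of a long box and the ratio-mixing induction -/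

/-- Intersections over a finite index set of events determined on `Λ` are determined on `Λ`. [folklore] -/
theorem biInter_mem_determinedOn {Λ : Set (Site 2)} (s : Finset ℕ) {E : ℕ → Set Obs} (hE : ∀ j ∈ s, E j ∈ determinedOn Λ) :
    (⋂ j ∈ s, E j) ∈ determinedOn Λ := by
  intro x y hxy
  simp only [Set.mem_iInter]
  exact forall₂_congr fun j hj => hE j hj x y hxy

/-- The black LR crossings of the squares `[a + 2jn, a + 2jn + n) × [b, b + n)`, `j ≤ m`, are all determined by the cells of the columns
`< a + 2mn + n` — at sup-distance `≥ n` to the LEFT of the next square `[a + 2(m+1)n, …)`. [folklore] -/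
theorem squares_mem_determinedOn_far (a b : ℤ) (n m : ℕ) :
    (⋂ j ∈ Finset.range (m + 1), lrCross (a + 2 * j * n) b n n) ∈ determinedOn (farFrom (a + 2 * (m + 1) * n) b n n n) := by
  refine biInter_mem_determinedOn _ fun j hj => determinedOn_mono (fun v hv => Or.inl ?_) (lrCross_mem_determinedOn _ b n n)
  have hjm : (j : ℤ) ≤ m := by exact_mod_cast Nat.lt_succ_iff.1 (Finset.mem_range.1 hj)
  simp only [Set.mem_setOf_eq] at hv
  nlinarith [hv.2.1, Int.natCast_nonneg n]

/-- A black LR crossing of the `(2m+1) n × n` box at `(a, b)` crosses all its `m + 1` odd squares (`lrCross_subset_subbox`). [folklore] -/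
theorem lrCross_long_subset_squares (a b : ℤ) {n : ℕ} (hn : 1 ≤ n) (m : ℕ) :
    lrCross a b ((2 * m + 1) * n) n ⊆ ⋂ j ∈ Finset.range (m + 1), lrCross (a + 2 * j * n) b n n := by
  refine Set.subset_iInter₂ fun j hj => ?_
  have hjm : j ≤ m := Nat.lt_succ_iff.1 (Finset.mem_range.1 hj)
  have h := lrCross_subset_subbox (a := a) (b := b) (h := n) (W := (2 * m + 1) * n) (w := n) (e := 2 * j * n) hn
    (by nlinarith)
  simpa [Nat.cast_mul, Nat.cast_ofNat, mul_assoc] using h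

/-- **THE RATIO-MIXING INDUCTION**: for `η > 0` and `n ≥ N(η)` (and `n ≥ 2`), the `ν_univ`-probability that the `m + 1` odd squares are all
crossed is at most `½ · ((1+η)/2)^m` — the first `m` squares' crossings are determined at sup-distance `≥ n` from the last square
(`squares_mem_determinedOn_far`), whose crossing has probability `½` (`pLR_square_univ`). [folklore] -/
theorem nu_squares_le {η : ℝ} (hη : 0 < η) {N : ℕ}
    (hN : ∀ (S : Set ℤ) (n : ℕ), N ≤ n → ∀ (a b : ℤ) (w h : ℕ), w ≤ 1 * n → h ≤ 1 * n →
      ∀ E L : Set Obs, MeasurableSet E → MeasurableSet L → RatioMixBound η S n a b w h E L)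
    (a b : ℤ) {n : ℕ} (hNn : N ≤ n) (hn2 : 2 ≤ n) :
    ∀ m : ℕ, (νmix Set.univ).real (⋂ j ∈ Finset.range (m + 1), lrCross (a + 2 * j * n) b n n) ≤ 1 / 2 * ((1 + η) / 2) ^ m := by
  have hsq : ∀ a' : ℤ, (νmix Set.univ).real (lrCross a' b n n) = 1 / 2 := fun a' => by
    rw [nuMix_real_lrCross, (univ_recentre stub_patternLocality a' b n n).1]
    exact pLR_square_univ stub_patternLocality stub_duality stub_quarterTurn hn2
  have hmeas : ∀ m : ℕ, MeasurableSet (⋂ j ∈ Finset.range (m + 1), lrCross (a + 2 * j * n) b n n) := fun m =>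
    Finset.measurableSet_biInter _ fun j _ => measurableSet_lrCross _ _ _ _
  intro m
  induction m with
  | zero => simp [hsq]
  | succ m ih =>
      have hsplit : (⋂ j ∈ Finset.range (m + 1 + 1), lrCross (a + 2 * j * n) b n n) =
          (⋂ j ∈ Finset.range (m + 1), lrCross (a + 2 * j * n) b n n) ∩ lrCross (a + 2 * (m + 1 : ℕ) * n) b n n := by
        rw [Finset.range_add_one, Finset.set_biInter_insert, Set.inter_comm]
      have hmix := hN Set.univ n hNn (a + 2 * (m + 1 : ℕ) * n) b n n (by omega) (by omega) _ _
        (hmeas m) (measurableSet_lrCross _ _ _ _) (by exact_mod_cast squares_mem_determinedOn_far a b n m)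
        (lrCross_mem_determinedOn _ _ _ _)
      have habs := (abs_le.1 hmix).2
      rw [hsq] at habs
      rw [hsplit]
      calc (νmix Set.univ).real ((⋂ j ∈ Finset.range (m + 1), lrCross (a + 2 * j * n) b n n) ∩
              lrCross (a + 2 * (m + 1 : ℕ) * n) b n n)
          ≤ (1 + η) * ((νmix Set.univ).real (⋂ j ∈ Finset.range (m + 1), lrCross (a + 2 * j * n) b n n) * (1 / 2)) := by
            linarith
        _ ≤ (1 + η) * ((1 / 2 * ((1 + η) / 2) ^ m) * (1 / 2)) := by gcongr
        _ = 1 / 2 * ((1 + η) / 2) ^ (m + 1) := by ring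

/-! ## §4 The decay theorems -/

/-- **Registered sub-goal `pureIK_hardCrossing_decay` — HARD CROSSINGS OF LONG ISOTROPIC BOXES DECAY EXPONENTIALLY**: for every `η > 0`
there is `N` such that for all `n ≥ N`, all `m` and all positions, `P_univ[LR((2m+1) n × n)] ≤ ½ · ((1+η)/2)^m`.  No positive association:
sub-boxes (`lrCross_long_subset_squares`) + ratio mixing (`stub_RatioMix`) + squares `= ½`; no `def`, proof lane. -/
theorem pureIK_hardCrossing_decay : ∀ η : ℝ, 0 < η → ∃ N : ℕ, ∀ (n m : ℕ) (a b : ℤ), N ≤ n →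
    pLR Set.univ a b ((2 * m + 1) * n) n ≤ 1 / 2 * ((1 + η) / 2) ^ m := by
  intro η hη
  obtain ⟨N, hN⟩ := stub_RatioMix 1 η hη
  refine ⟨max N 2, fun n m a b hn => ?_⟩
  haveI : IsProbabilityMeasure (νmix Set.univ) := isProbabilityMeasure_nuMix _
  rw [← nuMix_real_lrCross]
  exact (measureReal_mono (lrCross_long_subset_squares a b (by omega) m)).trans
    (nu_squares_le hη hN a b ((le_max_left _ _).trans hn) ((le_max_right _ _).trans hn) m)

/-- **The same for tall boxes**: `P_univ[BT(n × (2m+1) n)] ≤ ½ · ((1+η)/2)^m` for `n ≥ N(η)` (quarter turn). -/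
theorem pureIK_hardCrossing_decay_tb : ∀ η : ℝ, 0 < η → ∃ N : ℕ, ∀ (n m : ℕ) (a b : ℤ), N ≤ n →
    pTB Set.univ a b n ((2 * m + 1) * n) ≤ 1 / 2 * ((1 + η) / 2) ^ m := by
  intro η hη
  obtain ⟨N, hN⟩ := pureIK_hardCrossing_decay η hη
  refine ⟨N, fun n m a b hn => ?_⟩
  rw [(univ_recentre stub_patternLocality a b n _).2, stub_quarterTurn n ((2 * m + 1) * n)]
  exact hN n m _ 0 hn

/-- **SHORT-WAY CROSSINGS OF LONG ISOTROPIC BOXES ARE EXPONENTIALLY CERTAIN**: for `η > 0`, `n ≥ N(η)` (`N ≥ 2`),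
`P_univ[BT((2m+1) n × n)] ≥ 1 − ½ · ((1+η)/2)^m` (duality `pLR + pTB = 1`). -/
theorem pureIK_easyCrossing : ∀ η : ℝ, 0 < η → ∃ N : ℕ, ∀ (n m : ℕ) (a b : ℤ), N ≤ n →
    1 - 1 / 2 * ((1 + η) / 2) ^ m ≤ pTB Set.univ a b ((2 * m + 1) * n) n := by
  intro η hη
  obtain ⟨N, hN⟩ := pureIK_hardCrossing_decay η hη
  refine ⟨max N 2, fun n m a b hn => ?_⟩
  have h2 : 2 ≤ n := (le_max_right _ _).trans hn
  have hd := stub_duality Set.univ a b ((2 * m + 1) * n) n (by nlinarith) h2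
  have := hN n m a b ((le_max_left _ _).trans hn)
  linarith

end Summit.CriticalPhenomena.CardyFormulaZ2.Theorems.IKLinearTransport.PinnedDiagramExchange.HardCrossingDecay

end
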